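import Mathlib
import Summits.ValiantsHypothesis.ValiantsHypothesis.Theorems.KPlusLogSqLawWeakLiftingTowerGraftDiagonalDigits
import Summits.ValiantsHypothesis.ValiantsHypothesis.Theorems.KPlusLogSqLawWeakLiftingTowerGraftPivotCongruence
import Summits.ValiantsHypothesis.ValiantsHypothesis.Theorems.KPlusLogSqLawWeakLiftingTowerGraftKernelConfinement

/-!
# Tower graft line — (Er) for EVERY far letter: the top digit of `det(G + Y·S)` is a class determinant of size `m − rank S` (congruence)

Mechanism file for the line `Cruxes/WeakLifting/Lines/tower_graft.lean` (crux `WeakLifting` = stmt-ValiantsHypothesis-19561), memo §1 (Er);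
companion of `…TowerGraftDiagonalDigits.lean` (principal-minor expansion; top digit of a DIAGONAL graft).  NO stub is claimed.

* ★ `card_posRoots_topDigit_congr_le` — for the symmetric pencil `G = Σ X^{dₗ} Sₗ` of size `m`, `R` real invertible and the far letter
  `S = R·(Σ_{k∈A} sₖEₖₖ)·Rᵀ` (by Sylvester's law of inertia EVERY real symmetric letter has this form with `#A = rank S`, `sₖ = ±1`): writing
  `Q(Y) = det(G + Y·S) ∈ ℝ[X][Y]` (the memo's `Q(t,T)`), `Q` has no coefficient beyond `Y^{#A}` and **`Z₊([Y^{#A}]Q) ≤ B` under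
  `PosRootLawOn (m − #A) K B d`** — `[Y^{#A}]Q = det(R)²·(∏ sₖ)·det G₁[Aᶜ]` with `G₁` the congruent pencil (letters `R⁻¹SₗR⁻ᵀ`, same support).

READING: the event (Er) (branches of the graft curve escaping to `T = ∞` = real zeros of the top digit) is class-paid for EVERY far letter, any rank,
any signature; with (E0) = `det G` class-paid trivially, T3's only rank-dependent part is (Ed) (p709692/p710589 at rank two; mixed signature rank ≥ 3
open).  HONEST FRAMING: exact linear algebra; nothing on S4/S4b/S5/S5ᴸ, TowerB, `WeakLifting`, Conjecture B, `MatrixDescartes` (18050) or `VP ≠ VNP`.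
Def-free.  Seat: prover val-sym-lift-p2 g21, `--supports stmt-ValiantsHypothesis-19561`.
-/

-- `Summit.ValiantsHypothesis.ValiantsHypothesis.…` repeats a component by the D-0017 layout
-- (single-conjunct summit), which the `dupNamespace` linter flags; the name is mandated.
set_option linter.dupNamespace false

namespace Summit.ValiantsHypothesis.ValiantsHypothesis.Theorems.KPlusLogSqLaw.TowerGraft

open Polynomial Matrix
open scoped BigOperators Polynomial

section DiagonalEscapeCongr

open Summit.ValiantsHypothesis.ValiantsHypothesis.Theorems.LacunarySymmetroidMatrixDescartes (PosRootLawOn)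

/-- **(Er) FOR EVERY FAR LETTER CONGRUENT TO A DIAGONAL ONE** (by Sylvester: every real symmetric far letter).  For the symmetric pencil
`G = Σ X^{dₗ} Sₗ` of size `m`, `R` real invertible and the far letter `S = R·(Σ_{k∈A} sₖEₖₖ)·Rᵀ`, write `Q(Y) = det(G + Y·S) ∈ ℝ[X][Y]`.  Then `Q` has
no coefficient beyond `Y^{#A}`, and its top digit `[Y^{#A}]Q` has at most `B` positive roots under `PosRootLawOn (m − #A) K B d` (it is
`det(R)²·(∏ sₖ)` times the principal minor off `A` of the congruent pencil with letters `R⁻¹SₗR⁻ᵀ` — a class determinant of size `m − #A`). [this work] -/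
theorem card_posRoots_topDigit_congr_le {m K B : ℕ} (d : Fin K → ℕ) (A : Finset (Fin m)) (s : Fin m → ℝ)
    (hB : PosRootLawOn (m - A.card) K B d) (S : Fin K → Matrix (Fin m) (Fin m) ℝ) (hS : ∀ l, (S l).IsSymm)
    (R : Matrix (Fin m) (Fin m) ℝ) (hR : R.det ≠ 0) :
    let Q : ℝ[X][X] := ((∑ l, (X : ℝ[X]) ^ d l • (S l).map C).map (C : ℝ[X] →+* ℝ[X][X]) +
      (X : ℝ[X][X]) • (R * (∑ k ∈ A, s k • Matrix.single k k (1 : ℝ)) * Rᵀ).map ((C : ℝ[X] →+* ℝ[X][X]).comp (C : ℝ →+* ℝ[X]))).det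
    ((Q.coeff A.card).roots.toFinset.filter (fun t => 0 < t)).card ≤ B ∧ ∀ N, A.card < N → Q.coeff N = 0 := by
  intro Q
  classical
  -- the congruent pencil
  set T : Fin K → Matrix (Fin m) (Fin m) ℝ := fun l => (R⁻¹ᵀ)ᵀ * S l * R⁻¹ᵀ with hT
  have hTsymm : ∀ l, (T l).IsSymm := fun l => isSymm_transpose_mul_mul _ (hS l)
  set G₁ : Matrix (Fin m) (Fin m) ℝ[X] := ∑ l, (X : ℝ[X]) ^ d l • (T l).map C with hG₁
  have hRinv : R * R⁻¹ = 1 := Matrix.mul_nonsing_inv R (isUnit_iff_ne_zero.mpr hR)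
  have hG : (∑ l, (X : ℝ[X]) ^ d l • (S l).map C) = R.map C * G₁ * (R.map C)ᵀ := by
    rw [hG₁, ← transpose_mul_pencil_mul, ← Matrix.transpose_map, Matrix.transpose_transpose]
    have e1 : R.map (C : ℝ →+* ℝ[X]) * (R⁻¹).map C = 1 := by
      rw [← Matrix.map_mul, hRinv, Matrix.map_one _ (map_zero _) (map_one _)]
    have e2 : (R⁻¹)ᵀ.map (C : ℝ →+* ℝ[X]) * (R.map C)ᵀ = 1 := by
      rw [← Matrix.transpose_map, ← Matrix.map_mul, ← Matrix.transpose_mul, hRinv, Matrix.transpose_one,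
        Matrix.map_one _ (map_zero _) (map_one _)]
    calc (∑ l, (X : ℝ[X]) ^ d l • (S l).map C)
        = (R.map C * (R⁻¹).map C) * (∑ l, (X : ℝ[X]) ^ d l • (S l).map C) * ((R⁻¹)ᵀ.map C * (R.map C)ᵀ) := by
          rw [e1, e2, Matrix.one_mul, Matrix.mul_one]
      _ = R.map C * ((R⁻¹).map C * (∑ l, (X : ℝ[X]) ^ d l • (S l).map C) * (R⁻¹)ᵀ.map C) * (R.map C)ᵀ := by
          simp only [Matrix.mul_assoc]
  set CC : ℝ →+* ℝ[X][X] := (C : ℝ[X] →+* ℝ[X][X]).comp (C : ℝ →+* ℝ[X]) with hCC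
  have hdiag : (∑ k ∈ A, s k • Matrix.single k k (1 : ℝ)).map CC = ∑ k ∈ A, C (C (s k)) • Matrix.single k k (1 : ℝ[X][X]) := by
    ext i j
    simp [Matrix.sum_apply, Matrix.single_apply, hCC, apply_ite]
  have hQmat : ((∑ l, (X : ℝ[X]) ^ d l • (S l).map C).map (C : ℝ[X] →+* ℝ[X][X]) +
      (X : ℝ[X][X]) • (R * (∑ k ∈ A, s k • Matrix.single k k (1 : ℝ)) * Rᵀ).map CC) =
      R.map CC * (G₁.map (C : ℝ[X] →+* ℝ[X][X]) + (X : ℝ[X][X]) • ∑ k ∈ A, C (C (s k)) • Matrix.single k k (1 : ℝ[X][X])) *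
        (R.map CC)ᵀ := by
    rw [Matrix.mul_add, Matrix.add_mul, Matrix.mul_smul, Matrix.smul_mul, hG, Matrix.map_mul, Matrix.map_mul,
      ← Matrix.transpose_map, Matrix.map_map, Matrix.map_mul, Matrix.map_mul, ← Matrix.transpose_map, hdiag]
    rfl
  have hdetQ : Q = C (C (R.det ^ 2)) *
      (G₁.map (C : ℝ[X] →+* ℝ[X][X]) + (X : ℝ[X][X]) • ∑ k ∈ A, C (C (s k)) • Matrix.single k k (1 : ℝ[X][X])).det := by
    show (_ : Matrix _ _ ℝ[X][X]).det = _
    rw [hQmat, Matrix.det_mul, Matrix.det_mul, Matrix.det_transpose]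
    have hdR : (R.map CC).det = C (C R.det) := by
      rw [← RingHom.mapMatrix_apply, ← RingHom.map_det, hCC, RingHom.comp_apply]
    rw [hdR, map_pow, map_pow]
    ring
  obtain ⟨htop, hvan⟩ := coeff_card_det_map_add_X_smul_diagonal G₁ A (fun k => C (s k))
  refine ⟨?_, fun N hN => by rw [hdetQ, coeff_C_mul, hvan N hN, mul_zero]⟩
  rw [hdetQ, coeff_C_mul, htop, ← map_prod, ← mul_assoc, ← map_mul]
  by_cases hc : R.det ^ 2 * ∏ k ∈ A, s k = 0
  · rw [hc, map_zero, zero_mul, Polynomial.roots_zero, Multiset.toFinset_zero, Finset.filter_empty, Finset.card_empty]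
    exact Nat.zero_le _
  · rw [Polynomial.roots_C_mul _ hc]
    exact card_posRoots_topDigit_le d A hB T hTsymm

end DiagonalEscapeCongr

end Summit.ValiantsHypothesis.ValiantsHypothesis.Theorems.KPlusLogSqLaw.TowerGraft
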